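import Summits.RiemannHypothesis.RiemannHypothesis.Theorems.WeilColumnThetaPrimeBounds
import Summits.RiemannHypothesis.RiemannHypothesis.Theorems.WeilColumnThetaArchBound
import Summits.RiemannHypothesis.RiemannHypothesis.Theorems.WeilColumnYoungMollDeriv
import Summits.RiemannHypothesis.RiemannHypothesis.Theorems.WeilColumnOddMollifier
import Literature.NumberTheory.LFunctions.WeilSemilocalNegative
import HarnessLib

/-!
# THETA kernel certificate, PR Step 5 (abstract): the MAIN TERM AT MOLLIFICATION LEVEL `k` (RH-FREE)

Cell `rh-explicit`, WEIL column, seat handoff-prove-2 gen12 (THETA-ASSIGN §6 Step 5, over landed names).  ABSTRACT over the truncated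
odd tail: `T` continuous, `T = 0` beyond `x₁`, `‖T(u)‖ ≤ E·e^{(m+½)(u−x₁)}` everywhere; `f = T − T(−·)` of class `C¹` with compact support
in `[−a, a]`, `∫‖f‖² ≤ P.A`, `∫‖f′‖² ≤ P.B`; `0 < t₀ ≤ 1`; `ψ ≤ C·x` on `[0,∞)`.  Then for every `k` with `x₁ + 1/(k+1) < 0`, the
mollified `f_k = f ⋆ φ_k` satisfies (`weilQuadratic = polar − primes + arch` of `f_k ⋆ f̃_k` BY DEFINITION):

  **`Re Q(f_k) ≤ (2E_k²/(m+½))·vonMangoldtSum (m+1) + 2E_k²·√(e^{−2x₁,ₖ})·C·(e^{−m/(m+1)}/(m+1) + 1/m²) + P.arch t₀`**,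

`E_k = E·e^{(2m+1)/(k+1)}`, `x₁,ₖ = x₁ + 1/(k+1)` (`re_weilQuadratic_moll_oddTail_le`): D5 (`re_weilPolarTerm_weilConv_weilReflect_of_odd`,
`≤ 0`), D6 (`norm_weilPrimeTerm_oddTail_le` for the mollified tail `T ⋆ φ_k`, whose support edge and envelope inflate by the mollifier
radius — `weilConv_moll_tail_eq_zero`, `norm_weilConv_moll_tail_le`), D7 (`re_weilArchTerm_le_arch` through Young:
`integral_norm_sq_weilConv_moll_le`, `integral_norm_sq_deriv_weilConv_moll_le`).  As `k → ∞` the right side tends to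
`primesC + cross + arch t₀` of the un-mollified data.  Nothing here bears on the truth of RH.
-/

noncomputable section

set_option linter.dupNamespace false

open Complex Set MeasureTheory Filter Function
open scoped Real Topology ArithmeticFunction.vonMangoldt Chebyshev

namespace Summit.RiemannHypothesis.RiemannHypothesis.Theorems.WeilColumn.ThetaMellin

open Literature.NumberTheory.LFunctions Literature.NumberTheory.LFunctions.WeilContinuous

variable {T : ℝ → ℂ}

/-! ## §1 The mollified one-sided tail: support edge and envelope move by the mollifier radius -/

/-- If `T = 0` beyond `x₁` then `T ⋆ φ_k = 0` beyond `x₁ + 1/(k+1)`. -/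
theorem weilConv_moll_tail_eq_zero {x₁ : ℝ} (hT0 : ∀ u, x₁ < u → T u = 0) (k : ℕ) {u : ℝ}
    (hu : x₁ + 1 / ((k : ℝ) + 1) < u) : weilConv T (moll k) u = 0 := by
  rw [weilConv_apply]
  refine integral_eq_zero_of_ae (Eventually.of_forall fun v ↦ ?_)
  have hr : 0 < 1 / ((k : ℝ) + 1) := by positivity
  by_cases hv : x₁ < v
  · simp [hT0 v hv]
  · have hv' := not_lt.1 hv
    have hfar : (bump k).rOut ≤ |u - v| := by
      rw [bump_rOut, abs_of_nonneg (by linarith)]; linarith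
    simp [moll_eq_zero hfar]

/-- If `‖T(v)‖ ≤ E e^{κ(v−x₁)}` everywhere (`κ, E ≥ 0`) then `‖(T ⋆ φ_k)(u)‖ ≤ E e^{κ(u + 1/(k+1) − x₁)}`. -/
theorem norm_weilConv_moll_tail_le {x₁ E κ : ℝ} (hE : 0 ≤ E) (hκ : 0 ≤ κ)
    (hTE : ∀ v, ‖T v‖ ≤ E * Real.exp (κ * (v - x₁))) (k : ℕ) (u : ℝ) :
    ‖weilConv T (moll k) u‖ ≤ E * Real.exp (κ * (u + 1 / ((k : ℝ) + 1) - x₁)) := by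
  rw [weilConv_apply]
  set B := E * Real.exp (κ * (u + 1 / ((k : ℝ) + 1) - x₁)) with hB
  have hB0 : 0 ≤ B := by positivity
  have hint : Integrable fun v ↦ B * ‖moll k (u - v)‖ := ((integrable_norm_moll k).comp_sub_left u).const_mul B
  refine (norm_integral_le_of_norm_le hint (Eventually.of_forall fun v ↦ ?_)).trans (le_of_eq ?_)
  · rw [norm_mul]
    by_cases hv : |u - v| < (bump k).rOut
    · refine mul_le_mul_of_nonneg_right ((hTE v).trans ?_) (norm_nonneg _)
      refine mul_le_mul_of_nonneg_left (Real.exp_le_exp.2 (mul_le_mul_of_nonneg_left ?_ hκ)) hE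
      rw [bump_rOut] at hv
      linarith [(abs_lt.1 hv).1]
    · rw [moll_eq_zero (not_lt.1 hv), norm_zero, mul_zero, mul_zero]
  · rw [integral_const_mul, integral_norm_moll_sub, mul_one]

/-! ## §2 PR Step 5: the main term at level `k` -/

namespace ThetaParams

variable (P : ThetaParams)

/-- **PR Step 5 — the main term at mollification level `k`** (see the module docstring). [THETA-CERT-cc6 §D5–D7; THETA-ASSIGN §6] -/
theorem re_weilQuadratic_moll_oddTail_le {f : ℝ → ℂ} {E x₁ C a t₀ : ℝ} {qn : ℕ} (hP : P.Admissible qn)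
    (hTc : Continuous T) (hT0 : ∀ u, x₁ < u → T u = 0) (hE : 0 ≤ E)
    (hTE : ∀ u, ‖T u‖ ≤ E * Real.exp (((P.m : ℝ) + 1 / 2) * (u - x₁)))
    (hf : ∀ u, f u = T u - T (-u)) (hf1 : ContDiff ℝ 1 f) (hfs : HasCompactSupport f) (hsupp : tsupport f ⊆ Icc (-a) a)
    (hA : ∫ x, ‖f x‖ ^ 2 ≤ P.A) (hB : ∫ x, ‖deriv f x‖ ^ 2 ≤ P.B) (ht₀ : 0 < t₀) (ht₁ : t₀ ≤ 1)
    (hC : 0 ≤ C) (hψ : ∀ x : ℝ, 0 ≤ x → ψ x ≤ C * x) (k : ℕ) (hk : x₁ + 1 / ((k : ℝ) + 1) < 0) :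
    (weilQuadratic (weilConv f (moll k))).re ≤
      2 * (E * Real.exp ((2 * P.m + 1) / ((k : ℝ) + 1))) ^ 2 / ((P.m : ℝ) + 1 / 2) * vonMangoldtSum (P.m + 1) +
        2 * (E * Real.exp ((2 * P.m + 1) / ((k : ℝ) + 1))) ^ 2 * Real.sqrt (Real.exp (-2 * (x₁ + 1 / ((k : ℝ) + 1)))) *
          (C * (Real.exp (-((P.m : ℝ) / ((P.m : ℝ) + 1))) / ((P.m : ℝ) + 1) + 1 / (P.m : ℝ) ^ 2)) +
        P.arch t₀ := by
  have hm2 : 2 ≤ P.m := le_trans (by norm_num) hP.three_le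
  set r : ℝ := 1 / ((k : ℝ) + 1) with hr
  set g : ℝ → ℂ := weilConv f (moll k) with hgdef
  set Tk : ℝ → ℂ := weilConv T (moll k) with hTk
  have hr0 : 0 < r := by positivity
  have hκ : 0 ≤ (P.m : ℝ) + 1 / 2 := by positivity
  have hfc : Continuous f := hf1.continuous
  -- `g = Tk − Tk(−·)`
  have hfeq : f = fun u ↦ T u - T (-u) := funext hf
  have hg : ∀ u, g u = Tk u - Tk (-u) := fun u ↦ by
    simp only [hgdef, hTk]; rw [hfeq]; exact weilConv_oddPart_moll hTc k u
  -- the mollified tail: support edge `x₁ + r`, envelope `E e^{(2m+1)r}·e^{κ(u − (x₁+r))}`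
  have hTk0 : ∀ u, x₁ + r < u → Tk u = 0 := fun u hu ↦ weilConv_moll_tail_eq_zero hT0 k hu
  have hTkE : ∀ u, u ≤ x₁ + r → ‖Tk u‖ ≤ E * Real.exp ((2 * P.m + 1) / ((k : ℝ) + 1)) *
      Real.exp (((P.m : ℝ) + 1 / 2) * (u - (x₁ + r))) := by
    intro u _
    refine (norm_weilConv_moll_tail_le hE hκ hTE k u).trans (le_of_eq ?_)
    rw [mul_assoc, ← Real.exp_add]
    congr 2
    rw [hr]; field_simp; ring
  -- test-function facts for `g`
  have hgt : IsWeilTest g := isWeilTest_weilConv_moll hfc hfs k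
  have hfz : ∀ u, a < |u| → f u = 0 := by
    intro u hu
    by_contra hne
    have hmem := hsupp (subset_tsupport _ (Function.mem_support.2 hne))
    have : |u| ≤ a := abs_le.2 ⟨by linarith [hmem.1], hmem.2⟩
    linarith
  have hsuppg : tsupport g ⊆ Icc (-(a + 1)) (a + 1) := by
    refine closure_minimal (fun x hx ↦ ?_) isClosed_Icc
    rw [Function.mem_support] at hx
    by_contra h
    refine hx (weilConv_moll_eq_zero hfz ?_ k)
    rw [mem_Icc, not_and_or, not_le, not_le] at h
    rcases h with h | h
    · exact lt_of_lt_of_le (by linarith) (neg_le_abs x)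
    · exact lt_of_lt_of_le h (le_abs_self x)
  have hodd : ∀ t, g (-t) = -g t := fun t ↦ by rw [hg, hg, neg_neg]; ring
  -- D5, D6, D7
  have hD5 : (weilPolarTerm (weilConv g (weilReflect g))).re ≤ 0 := by
    rw [re_weilPolarTerm_weilConv_weilReflect_of_odd hgt hodd]
    nlinarith [norm_nonneg (weilMellin g 0)]
  have hE' : 0 ≤ E * Real.exp ((2 * P.m + 1) / ((k : ℝ) + 1)) := by positivity
  have hD6 := norm_weilPrimeTerm_oddTail_le (a := a + 1) hm2 hk hE' hTk0 hTkE hgt hsuppg hg hC hψ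
  have hA' : ∫ x, ‖g x‖ ^ 2 ≤ P.A := (integral_norm_sq_weilConv_moll_le hfc hfs k).trans hA
  have hB' : ∫ x, ‖deriv g x‖ ^ 2 ≤ P.B := (integral_norm_sq_deriv_weilConv_moll_le hf1 hfs k).trans hB
  have hD7 := P.re_weilArchTerm_le_arch hgt hA' hB' ht₀ ht₁
  -- assemble
  have hre : (weilQuadratic g).re = (weilPolarTerm (weilConv g (weilReflect g))).re -
      (weilPrimeTerm (weilConv g (weilReflect g))).re + (weilArchTerm (weilConv g (weilReflect g))).re := by
    simp [weilQuadratic, weilFunctional]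
  have hP6 : -(weilPrimeTerm (weilConv g (weilReflect g))).re ≤ ‖weilPrimeTerm (weilConv g (weilReflect g))‖ := by
    have := Complex.abs_re_le_norm (weilPrimeTerm (weilConv g (weilReflect g)))
    exact (neg_le_abs _).trans this
  rw [hre]
  linarith

end ThetaParams

end Summit.RiemannHypothesis.RiemannHypothesis.Theorems.WeilColumn.ThetaMellin

end
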